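import Summits.ABC.ABC.Theorems.SoloBlindBakerXi
import Summits.ABC.ABC.Theorems.SoloBlindPolyABC
import HarnessLib.Audit
import HarnessLib

/-!
# Requirement (i) alone: an all-places estimate with the *product* of the heights gives only
# subexponential abc (solo-ABC-blind, generation 3)

Companion of `SoloBlindBakerXi` and `SoloBlindXiHierarchy`.  Baker [Baker2004, §2, p. 256] describes a
result of abc strength as (i) replacing `|Λ|` by the all-places quantity `Ξ` in the Baker–Wüstholz
estimate `log |Λ| > −C(n, d) h'(α₁) ⋯ h'(αₙ) h'(L)` **together with** (ii) replacing the product of the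
heights by their sum.  Here we type requirement (i) *alone* — the Baker–Wüstholz/Matveev dependence
`C^n ∏ log pᵢ · log B` kept, but granted at all places simultaneously — and prove that it yields exactly a
*subexponential* abc inequality `log c ≤ K_ε rad(abc)^ε` (every `ε > 0`), and nothing polynomial:

* `ProductXiBound` — there is `C > 0` with `log Ξ(a,b) ≥ −(∏_{p ∣ ab} C log p) · log log a` for coprime
  `0 < b < a`, `a ≥ 3` (note `∏_{p ∣ ab} C log p = C^{ω(ab)} ∏ log p`; for `a − b ∈ {1, 2}` one has
  `Ξ ≍ |Λ|` and this is the shape of the known archimedean bound).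
* `SubexpABC` — `∀ ε > 0 ∃ K ∀ abc triples, log c ≤ K · rad(abc)^ε` (open; known: `log c ≪ rad^{1/3}(log rad)^3`).
* `exists_prod_primeFactors_log_le` — the anatomy step `∏_{p ∣ m} C log p ≤ K(C, ε) · rad(m)^ε`.
* `subexpABC_of_productXi` — **(i) alone gives `SubexpABC`**; `subexpABC_of_polyABC` — so does any `PolyABC K`.

Reading (WALL C1 of this seat, quantified): on the scale  known `exp(R^{1/3+o(1)})` · (i) alone `exp(R^{o(1)})`
· (i)+(ii) with `log u` kept `R^{O(log log c)}` (`SoloBlindXiHierarchy`) · polynomial `R^K` · abc `R^{1+ε}`,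
requirement (i) is worth the step `R^{1/3} → R^{o(1)}` in the exponent and requirement (ii) everything else.
Elementary; nothing here is claimed new. [cite: Baker2004, §2 (p. 256)] [cite: BakerWustholz2007, §3.7]
-/

noncomputable section

open UniqueFactorizationMonoid Finset Filter Asymptotics

namespace Summit.ABC.ABC.Theorems

open Literature.NumberTheory.DiophantineGeometry

/-! ### Statements -/

/-- **Subexponential abc**: for every `ε > 0` there is `K` with `log c ≤ K · rad(abc)^ε` for all abc
triples.  Open (Stewart–Yu 2001: `log c ≪ rad^{1/3} (log rad)^3`); implied by every `PolyABC K`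
(`subexpABC_of_polyABC`) and by requirement (i) alone (`subexpABC_of_productXi`).
[cite: Baker2004, §2 (p. 255)] [status: open] -/
@[conjecture] def SubexpABC : Prop :=
  ∀ ε : ℝ, 0 < ε → ∃ K : ℝ, ∀ x y z : ℕ, IsABCTriple x y z →
    Real.log (z : ℝ) ≤ K * ((rad x y z : ℕ) : ℝ) ^ ε

/-- **Requirement (i) alone** [Baker2004, §2, p. 256]: the Baker–Wüstholz/Matveev shape
`C^n ∏ h'(αᵢ) · h'(L)` granted for the all-places quantity `Ξ` of `Λ = log(a/b)`, typed over `bakerXi`: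
there is `C > 0` with `log Ξ(a,b) ≥ −(∏_{p ∣ ab} C · log p) · log log a` for all coprime `0 < b < a`, `a ≥ 3`.
Open; implies only `SubexpABC` (`subexpABC_of_productXi`). [cite: Baker2004, §2 (p. 256)] [status: open] -/
@[conjecture] def ProductXiBound : Prop :=
  ∃ C : ℝ, 0 < C ∧ ∀ a b : ℕ, 0 < b → b < a → 3 ≤ a → Nat.Coprime a b →
    -(∏ p ∈ (a * b).primeFactors, C * Real.log (p : ℝ)) * Real.log (Real.log (a : ℝ))
      ≤ Real.log (bakerXi a b)

/-! ### Anatomy: `∏_{p ∣ m} C log p ≤ K · rad(m)^ε` -/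

/-- For `C, ε > 0` there is `K > 0` with `∏_{p ∣ m} (C log p) ≤ K · rad(m)^ε` for all `m ≠ 0`
(only the finitely many primes with `C log p > p^ε` contribute to `K`). [folklore] -/
theorem exists_prod_primeFactors_log_le {C ε : ℝ} (hC : 0 < C) (hε : 0 < ε) :
    ∃ K : ℝ, 0 < K ∧ ∀ m : ℕ, m ≠ 0 →
      ∏ p ∈ m.primeFactors, C * Real.log (p : ℝ) ≤ K * ((radical m : ℕ) : ℝ) ^ ε := by
  classical
  -- eventually `log x ≤ C⁻¹ x^ε`
  have hlo := (isLittleO_log_rpow_atTop hε).def (inv_pos.mpr hC)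
  obtain ⟨x₀, hx₀⟩ := Filter.eventually_atTop.mp hlo
  set N₀ : ℕ := ⌈x₀⌉₊ + 1 with hN₀
  set g : ℕ → ℝ := fun p => C * Real.log (p : ℝ) / (p : ℝ) ^ ε with hg
  set K : ℝ := ∏ p ∈ Finset.range N₀, max 1 (g p) with hK
  have hone_le : ∀ (T : Finset ℕ), (1 : ℝ) ≤ ∏ p ∈ T, max 1 (g p) := by
    intro T
    calc (1 : ℝ) = ∏ p ∈ T, (1 : ℝ) := by simp
      _ ≤ ∏ p ∈ T, max 1 (g p) :=
        Finset.prod_le_prod (fun _ _ => zero_le_one) (fun _ _ => le_max_left _ _)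
  have hK1 : 1 ≤ K := hone_le _
  refine ⟨K, by linarith, fun m hm => ?_⟩
  have hp_pos : ∀ p ∈ m.primeFactors, (0 : ℝ) < (p : ℝ) := fun p hp => by
    exact_mod_cast (Nat.prime_of_mem_primeFactors hp).pos
  have hp_one : ∀ p ∈ m.primeFactors, (1 : ℝ) ≤ (p : ℝ) := fun p hp => by
    exact_mod_cast (Nat.prime_of_mem_primeFactors hp).one_le
  -- split each factor: `C log p = p^ε · g p`
  have hsplit : ∏ p ∈ m.primeFactors, C * Real.log (p : ℝ)
      = (∏ p ∈ m.primeFactors, (p : ℝ) ^ ε) * ∏ p ∈ m.primeFactors, g p := by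
    rw [← Finset.prod_mul_distrib]
    refine Finset.prod_congr rfl (fun p hp => ?_)
    have : (0 : ℝ) < (p : ℝ) ^ ε := Real.rpow_pos_of_pos (hp_pos p hp) ε
    rw [hg]
    field_simp
  -- the first product is `rad(m)^ε`
  have hrad : (∏ p ∈ m.primeFactors, (p : ℝ) ^ ε) = ((radical m : ℕ) : ℝ) ^ ε := by
    rw [Real.finsetProd_rpow m.primeFactors (fun p => (p : ℝ)) (fun p hp => (hp_pos p hp).le),
      Nat.radical_eq_prod_primeFactors, Nat.cast_prod]
  -- the second product is at most `K`
  have hg0 : ∀ p ∈ m.primeFactors, 0 ≤ g p := fun p hp => by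
    rw [hg]
    exact div_nonneg (mul_nonneg hC.le (Real.log_nonneg (hp_one p hp)))
      (Real.rpow_nonneg (hp_pos p hp).le ε)
  have hg_le : ∀ p ∈ m.primeFactors, p ∉ Finset.range N₀ → g p ≤ 1 := by
    intro p hp hpN
    rw [Finset.mem_range, not_lt] at hpN
    have hpx : x₀ ≤ (p : ℝ) := by
      have h1 : x₀ ≤ ⌈x₀⌉₊ := Nat.le_ceil x₀
      have h2 : ((⌈x₀⌉₊ + 1 : ℕ) : ℝ) ≤ (p : ℝ) := by exact_mod_cast hpN
      push_cast at h2
      linarith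
    have h := hx₀ (p : ℝ) hpx
    rw [Real.norm_eq_abs, Real.norm_eq_abs, abs_of_nonneg (Real.log_nonneg (hp_one p hp)),
      abs_of_nonneg (Real.rpow_nonneg (hp_pos p hp).le ε)] at h
    have hpε : (0 : ℝ) < (p : ℝ) ^ ε := Real.rpow_pos_of_pos (hp_pos p hp) ε
    rw [hg, div_le_one hpε]
    calc C * Real.log (p : ℝ) ≤ C * (C⁻¹ * (p : ℝ) ^ ε) := by gcongr
      _ = (p : ℝ) ^ ε := by field_simp
  have hprod_le : ∏ p ∈ m.primeFactors, g p ≤ K := by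
    have hsd : ∏ p ∈ m.primeFactors \ Finset.range N₀, max 1 (g p) = 1 := by
      refine Finset.prod_eq_one (fun p hp => ?_)
      rw [Finset.mem_sdiff] at hp
      exact max_eq_left (hg_le p hp.1 hp.2)
    have hnonneg : (0 : ℝ) ≤ ∏ p ∈ Finset.range N₀ ∩ m.primeFactors, max 1 (g p) :=
      Finset.prod_nonneg (fun p _ => le_trans zero_le_one (le_max_left _ _))
    calc ∏ p ∈ m.primeFactors, g p ≤ ∏ p ∈ m.primeFactors, max 1 (g p) :=
          Finset.prod_le_prod hg0 (fun p _ => le_max_right _ _)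
      _ = (∏ p ∈ m.primeFactors ∩ Finset.range N₀, max 1 (g p))
            * ∏ p ∈ m.primeFactors \ Finset.range N₀, max 1 (g p) :=
          (Finset.prod_inter_mul_prod_sdiff m.primeFactors (Finset.range N₀) _).symm
      _ = ∏ p ∈ Finset.range N₀ ∩ m.primeFactors, max 1 (g p) := by
          rw [hsd, mul_one, Finset.inter_comm]
      _ ≤ (∏ p ∈ Finset.range N₀ ∩ m.primeFactors, max 1 (g p))
            * ∏ p ∈ Finset.range N₀ \ m.primeFactors, max 1 (g p) :=
          le_mul_of_one_le_right hnonneg (hone_le _)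
      _ = K := by rw [hK, Finset.prod_inter_mul_prod_sdiff]
  have hradε : (0 : ℝ) ≤ ((radical m : ℕ) : ℝ) ^ ε := Real.rpow_nonneg (by positivity) ε
  rw [hsplit, hrad]
  calc ((radical m : ℕ) : ℝ) ^ ε * ∏ p ∈ m.primeFactors, g p
      ≤ ((radical m : ℕ) : ℝ) ^ ε * K := mul_le_mul_of_nonneg_left hprod_le hradε
    _ = K * ((radical m : ℕ) : ℝ) ^ ε := mul_comm _ _

/-! ### Requirement (i) alone ⟹ subexponential abc -/

/-- The ordered case `x ≤ y`: from `ProductXiBound` (constant `C`) and the anatomy bound (constant `K`,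
exponent `ε`), `log z ≤ 2 log R + K R^ε log log z` for an abc triple `x + y = z`, `z ≥ 3`, `R = rad(xyz)`.
[folklore] -/
theorem log_le_of_productXi {C K ε : ℝ} (hK : 0 ≤ K) (hε : 0 < ε)
    (H : ∀ a b : ℕ, 0 < b → b < a → 3 ≤ a → Nat.Coprime a b →
      -(∏ p ∈ (a * b).primeFactors, C * Real.log (p : ℝ)) * Real.log (Real.log (a : ℝ))
        ≤ Real.log (bakerXi a b))
    (hKm : ∀ m : ℕ, m ≠ 0 →
      ∏ p ∈ m.primeFactors, C * Real.log (p : ℝ) ≤ K * ((radical m : ℕ) : ℝ) ^ ε)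
    {x y z : ℕ} (h : IsABCTriple x y z) (hz : 3 ≤ z) (hxy : x ≤ y) :
    Real.log (z : ℝ) ≤ 2 * Real.log ((rad x y z : ℕ) : ℝ)
      + K * ((rad x y z : ℕ) : ℝ) ^ ε * Real.log (Real.log (z : ℝ)) := by
  have hmul := rad_eq_mul_of_isABCTriple h
  obtain ⟨hx, hy, hxyz, hcop⟩ := h
  have hyz : y < z := by omega
  have hzy : Nat.Coprime z y := by
    rw [← hxyz]; exact Nat.coprime_add_self_left.mpr hcop
  have hz3 : (3 : ℝ) ≤ (z : ℝ) := by exact_mod_cast hz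
  have hz0 : (0 : ℝ) < (z : ℝ) := by linarith
  have hy0 : (0 : ℝ) < (y : ℝ) := by exact_mod_cast hy
  set rx : ℝ := ((radical x : ℕ) : ℝ) with hrx
  set ry : ℝ := ((radical y : ℕ) : ℝ) with hry
  set rz : ℝ := ((radical z : ℕ) : ℝ) with hrz
  set R : ℝ := ((rad x y z : ℕ) : ℝ) with hRdef
  have hrx1 : (1 : ℝ) ≤ rx := by rw [hrx]; exact_mod_cast Nat.radical_pos x
  have hry1 : (1 : ℝ) ≤ ry := by rw [hry]; exact_mod_cast Nat.radical_pos y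
  have hrz1 : (1 : ℝ) ≤ rz := by rw [hrz]; exact_mod_cast Nat.radical_pos z
  have hR2 : (2 : ℝ) ≤ R := by
    have h2 : 2 ≤ rad x y z := by
      rw [rad_def, Nat.two_le_radical_iff]
      have : 1 ≤ x * y := Nat.one_le_iff_ne_zero.mpr (Nat.mul_ne_zero (by omega) (by omega))
      nlinarith
    rw [hRdef]; exact_mod_cast h2
  have hRpos : (0 : ℝ) < R := by linarith
  -- (i) at (a, b) = (z, y): Ξ(z, y) ≤ rad(z − y)/y = rad(x)/y
  have hH := H z y hy hyz hz hzy
  rw [neg_mul] at hH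
  have hsub : z - y = x := by omega
  have hXi_le : bakerXi z y ≤ rx / (y : ℝ) := by
    have := bakerXi_le_radical_div hy hyz
    rwa [hsub] at this
  have hXi_pos : 0 < bakerXi z y := by
    have h1 := radical_div_le_bakerXi hy hyz
    rw [hsub] at h1
    have h2 : (0 : ℝ) < rx / (z : ℝ) := by positivity
    linarith
  have hlogXi : Real.log (bakerXi z y) ≤ Real.log rx - Real.log (y : ℝ) := by
    rw [← Real.log_div (by positivity) hy0.ne']
    exact Real.log_le_log hXi_pos hXi_le
  -- anatomy on `m = z * y`, `rad(z y) = rad z · rad y ≤ R`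
  have hKzy := hKm (z * y) (Nat.mul_ne_zero (by omega) (by omega))
  have hradzy : ((radical (z * y) : ℕ) : ℝ) = rz * ry := by
    rw [radical_mul (Nat.coprime_iff_isRelPrime.mp hzy)]; push_cast; rw [hrz, hry]
  have hzyR : rz * ry ≤ R := by
    rw [hmul]
    have : 1 * ry * rz ≤ rx * ry * rz := by gcongr
    linarith
  have hPle : ∏ p ∈ (z * y).primeFactors, C * Real.log (p : ℝ) ≤ K * R ^ ε := by
    refine hKzy.trans ?_
    rw [hradzy]
    exact mul_le_mul_of_nonneg_left (Real.rpow_le_rpow (by positivity) hzyR hε.le) hK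
  -- logarithm bookkeeping
  have hLL : 0 ≤ Real.log (Real.log (z : ℝ)) := by
    apply Real.log_nonneg
    rw [Real.le_log_iff_exp_le hz0]
    have := Real.exp_one_lt_d9
    linarith
  have hlogrx : Real.log rx ≤ Real.log R := by
    apply Real.log_le_log (by positivity)
    rw [hmul]
    have : rx * 1 * 1 ≤ rx * ry * rz := by gcongr
    linarith
  have hlog2 : Real.log 2 ≤ Real.log R := Real.log_le_log (by norm_num) hR2
  have hz2y : (z : ℝ) ≤ 2 * (y : ℝ) := by
    have : z ≤ 2 * y := by omega
    exact_mod_cast this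
  have hlogz : Real.log (z : ℝ) ≤ Real.log 2 + Real.log (y : ℝ) := by
    rw [← Real.log_mul (by norm_num) hy0.ne']
    exact Real.log_le_log hz0 hz2y
  have hPLL : (∏ p ∈ (z * y).primeFactors, C * Real.log (p : ℝ)) * Real.log (Real.log (z : ℝ))
      ≤ K * R ^ ε * Real.log (Real.log (z : ℝ)) := mul_le_mul_of_nonneg_right hPle hLL
  linarith [hH, hlogXi, hlogrx, hlog2, hlogz, hPLL]

/-- **Requirement (i) alone gives subexponential abc**: `ProductXiBound → SubexpABC`
(constant `K_ε = 4/ε + 4 K(C, ε/2)² + 1`). [folklore] -/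
theorem subexpABC_of_productXi (hP : ProductXiBound) : SubexpABC := by
  obtain ⟨C, hC, H⟩ := hP
  intro ε hε
  have hε2 : 0 < ε / 2 := by positivity
  obtain ⟨K, hK, hKm⟩ := exists_prod_primeFactors_log_le hC hε2
  refine ⟨4 / ε + 4 * K ^ 2 + 1, fun x y z h => ?_⟩
  have hmul := rad_eq_mul_of_isABCTriple h
  set R : ℝ := ((rad x y z : ℕ) : ℝ) with hRdef
  have hR1 : (1 : ℝ) ≤ R := by
    rw [hRdef, rad_def]; exact_mod_cast Nat.radical_pos _
  have hR0 : (0 : ℝ) < R := by linarith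
  have hRε1 : 1 ≤ R ^ ε := Real.one_le_rpow hR1 hε.le
  have hcoef : 1 ≤ 4 / ε + 4 * K ^ 2 + 1 := by
    have : 0 ≤ 4 / ε := by positivity
    nlinarith [sq_nonneg K]
  rcases lt_or_ge z 3 with hz | hz
  · -- z ≤ 2: log z ≤ log 2 < 1 ≤ RHS
    obtain ⟨hx, hy, hxyz, -⟩ := h
    have hz2 : (z : ℝ) ≤ 2 := by exact_mod_cast (show z ≤ 2 by omega)
    have hz0 : (0 : ℝ) < (z : ℝ) := by exact_mod_cast (show 0 < z by omega)
    have h1 : Real.log (z : ℝ) ≤ Real.log 2 := Real.log_le_log hz0 hz2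
    have h2 := Real.log_two_lt_d9
    nlinarith
  · -- z ≥ 3: L ≤ 2 log R + K R^{ε/2} log L, then absorb log L ≤ 2 √L
    have hmain : Real.log (z : ℝ) ≤ 2 * Real.log R
        + K * R ^ (ε / 2) * Real.log (Real.log (z : ℝ)) := by
      rcases le_or_gt x y with hxy | hyx
      · exact log_le_of_productXi hK.le hε2 H hKm h hz hxy
      · obtain ⟨hx, hy, hxyz, hcop⟩ := h
        have h' : IsABCTriple y x z := ⟨hy, hx, by omega, hcop.symm⟩
        have hrad : rad y x z = rad x y z := by rw [rad_def, rad_def, mul_comm y x]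
        have := log_le_of_productXi hK.le hε2 H hKm h' hz hyx.le
        rwa [hrad] at this
    have hz3 : (3 : ℝ) ≤ (z : ℝ) := by exact_mod_cast hz
    set L : ℝ := Real.log (z : ℝ) with hLdef
    have hL1 : 1 ≤ L := by
      rw [hLdef, Real.le_log_iff_exp_le (by linarith)]
      have := Real.exp_one_lt_d9
      linarith
    have hL0 : 0 ≤ L := by linarith
    -- log L ≤ 2 √L
    have hlogL : Real.log L ≤ 2 * Real.sqrt L := by
      have h1 := Real.log_le_rpow_div hL0 (show (0 : ℝ) < 1 / 2 by norm_num)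
      rw [← Real.sqrt_eq_rpow L] at h1
      linarith
    set s : ℝ := Real.sqrt L with hsdef
    have hs2 : s ^ 2 = L := Real.sq_sqrt hL0
    have hs0 : 0 ≤ s := Real.sqrt_nonneg L
    set b : ℝ := K * R ^ (ε / 2) with hbdef
    have hb0 : 0 ≤ b := by positivity
    have hb2 : b ^ 2 = K ^ 2 * R ^ ε := by
      rw [hbdef, mul_pow, ← Real.rpow_two (R ^ (ε / 2)), ← Real.rpow_mul hR0.le]
      ring_nf
    -- L ≤ 2 log R + 2 b s ⟹ L ≤ 4 log R + 4 b²
    have hL_le : L ≤ 2 * Real.log R + 2 * b * s := by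
      have : K * R ^ (ε / 2) * Real.log L ≤ b * (2 * s) := by
        rw [hbdef]; exact mul_le_mul_of_nonneg_left hlogL hb0
      linarith [hmain]
    have hL_le2 : L ≤ 4 * Real.log R + 4 * b ^ 2 := by
      nlinarith [sq_nonneg (2 * b - s), hL_le, hs2]
    -- log R ≤ R^ε / ε
    have hlogR : Real.log R ≤ R ^ ε / ε := Real.log_le_rpow_div hR0.le hε
    have hlogR' : 4 * Real.log R ≤ 4 / ε * R ^ ε := by
      rw [div_mul_eq_mul_div, le_div_iff₀ hε]
      have := mul_le_mul_of_nonneg_left hlogR (show (0 : ℝ) ≤ 4 by norm_num)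
      rw [mul_div_assoc'] at this
      rw [le_div_iff₀ hε] at this
      linarith
    calc L ≤ 4 * Real.log R + 4 * b ^ 2 := hL_le2
      _ ≤ 4 / ε * R ^ ε + 4 * (K ^ 2 * R ^ ε) := by rw [← hb2]; linarith
      _ = (4 / ε + 4 * K ^ 2) * R ^ ε := by ring
      _ ≤ (4 / ε + 4 * K ^ 2 + 1) * R ^ ε := by nlinarith

/-- `PolyABC K → SubexpABC`. [folklore] -/
theorem subexpABC_of_polyABC {K : ℝ} (hP : PolyABC K) : SubexpABC := by
  have hK := polyABC_pos hP
  obtain ⟨C, hC, HC⟩ := hP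
  intro ε hε
  refine ⟨|Real.log C| + K / ε, fun x y z h => ?_⟩
  have h1 := HC x y z h
  obtain ⟨hx, hy, hxyz, -⟩ := h
  set R : ℝ := ((rad x y z : ℕ) : ℝ) with hRdef
  have hR1 : (1 : ℝ) ≤ R := by
    rw [hRdef, rad_def]; exact_mod_cast Nat.radical_pos _
  have hR0 : (0 : ℝ) < R := by linarith
  have hRε1 : 1 ≤ R ^ ε := Real.one_le_rpow hR1 hε.le
  have hz0 : (0 : ℝ) < (z : ℝ) := by exact_mod_cast (show 0 < z by omega)
  have hlogz : Real.log (z : ℝ) ≤ Real.log C + K * Real.log R := by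
    have := Real.log_le_log hz0 h1
    rwa [Real.log_mul hC.ne' (by positivity), Real.log_rpow hR0] at this
  have hlogR : Real.log R ≤ R ^ ε / ε := Real.log_le_rpow_div hR0.le hε
  have hlogC : Real.log C ≤ |Real.log C| * R ^ ε := by
    calc Real.log C ≤ |Real.log C| := le_abs_self _
      _ = |Real.log C| * 1 := (mul_one _).symm
      _ ≤ |Real.log C| * R ^ ε := mul_le_mul_of_nonneg_left hRε1 (abs_nonneg _)
  have hKlog : K * Real.log R ≤ K / ε * R ^ ε := by
    rw [div_mul_eq_mul_div, le_div_iff₀ hε]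
    have := mul_le_mul_of_nonneg_left hlogR hK.le
    rw [mul_div_assoc'] at this
    rw [le_div_iff₀ hε] at this
    linarith
  calc Real.log (z : ℝ) ≤ Real.log C + K * Real.log R := hlogz
    _ ≤ |Real.log C| * R ^ ε + K / ε * R ^ ε := by linarith
    _ = (|Real.log C| + K / ε) * R ^ ε := by ring

end Summit.ABC.ABC.Theorems
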